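import Literature.AnabelianGeometry.SemiGraphs.TemperedAnabelian

/-!
# Profinite completions: open subgroups of finite index, open images, descent of conjugators
# (classical lemmas over the interface `IsProfiniteCompletion` of [SemiAnbd] §6)

Mochizuki, *Semi-graphs of anabelioids*, Publ. RIMS **42** (2006) [SemiAnbd], §6 p. 69 ("we shall
denote the profinite completion of a group by means of a `∧`"; "natural injections
`Π^temp_{X_K} ↪ Π_{X_K}`") and the proof of Theorem 6.4 p. 71 ("given a homomorphism `φ` of
DOF-type, profinite completion yields an open homomorphism `φ̂`"; "by Lemma 6.3, (iii), we thus
conclude that `φ` differs from `ψ` by composition with an inner automorphism").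
[cite: MochizukiSemiAnbd2006, §6 p.69, Thm 6.4 proof p.71]

PROOF-ONLY companion of `TemperedAnabelian.lean` (abc-iut cell, prover abc-iut-w5-d139, sub-DAG
`SemiAnbd:Thm6.4` rows T64-L03b / T64-L07): CLASSICAL topological group theory over the interface
`IsProfiniteCompletion ι` (compact Hausdorff totally disconnected target, dense range, the open normal
subgroups of finite index of `F` are pulled back from `F̂`) and Definition 6.2 (ii) `IsDOFType`:

* `closure_image_comap` — for an open normal `V ≤ F̂`, the closure of `ι(ι⁻¹ V)` is `V`;
* `exists_openNormal_le` / `isOpen_topologicalClosure_map` / `comap_topologicalClosure_map` — for an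
  OPEN subgroup `U ≤ F` of FINITE INDEX: the closure `Û` of `ι(U)` in `F̂` contains an open normal
  subgroup, is open, and `ι⁻¹(Û) = U`;
* `isOpen_range_of_extends` — (row T64-L03b, generic form) if `φ : F → F₂` has DOF-type image and
  `Φ : F̂ → F̂₂` extends `φ` along the completions, then `Φ` has OPEN image;
* `outer_descent_of_openDenseDOFConjugator` — (row T64-L07 ⇐ T64-L06′, generic form) if Lemma 6.3
  (iii) holds for every open finite-index subgroup of `F` (the hypothesis `h63`, verbatim the shape of
  `TemperedCurve.OpenDenseDOFConjugator`), `ι` is injective, and two homomorphisms `φ, ψ` into `F`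
  with DOF-type images become conjugate by `c ∈ F̂` after `ι`, then they are conjugate by an element
  of `F`.
No new definition, no fact; Mathlib only. Nothing here takes a side on [IUTchIII] Cor. 3.12.
-/

noncomputable section

namespace Literature.AnabelianGeometry.SemiGraphs

namespace IsProfiniteCompletion

open scoped Pointwise
open Topology

universe u v w u' v'

variable {F : Type u} {Fhat : Type v} [Group F] [TopologicalSpace F] [IsTopologicalGroup F]
  [Group Fhat] [TopologicalSpace Fhat] [IsTopologicalGroup Fhat] {ι : F →ₜ* Fhat}

/-- The normal core of an open subgroup of finite index is open (it is closed of finite index).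
[folklore] -/
private theorem isOpen_normalCore (U : Subgroup F) (hU : IsOpen (U : Set F)) [U.FiniteIndex] :
    IsOpen (U.normalCore : Set F) :=
  Subgroup.isOpen_of_isClosed_of_finiteIndex _ (U.normalCore_isClosed (U.isClosed_of_isOpen hU))

omit [IsTopologicalGroup F] in
/-- The coercion bookkeeping: `↑((U.map ι).topologicalClosure) = closure (ι '' U)`. [folklore] -/
private theorem coe_topologicalClosure_map (U : Subgroup F) :
    (((U.map ι.toMonoidHom).topologicalClosure : Subgroup Fhat) : Set Fhat) =
      closure (ι '' (U : Set F)) := by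
  rw [Subgroup.topologicalClosure_coe, Subgroup.coe_map]
  rfl

omit [IsTopologicalGroup F] in
/-- For an open normal subgroup `V ≤ F̂` of the profinite completion, `ι(ι⁻¹(V)) = V ∩ ι(F)` is dense
in `V`: its closure is `V`. [cite: MochizukiSemiAnbd2006, §6 p.69] -/
theorem closure_image_comap (hι : IsProfiniteCompletion ι) (V : OpenNormalSubgroup Fhat) :
    closure (ι '' ((V.toSubgroup.comap ι.toMonoidHom : Subgroup F) : Set F)) =
      (V.toSubgroup : Set Fhat) := by
  have himg : ι '' ((V.toSubgroup.comap ι.toMonoidHom : Subgroup F) : Set F) =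
      (V.toSubgroup : Set Fhat) ∩ Set.range ι := by
    ext z
    constructor
    · rintro ⟨x, hx, rfl⟩
      exact ⟨hx, x, rfl⟩
    · rintro ⟨hz, x, rfl⟩
      exact ⟨x, hz, rfl⟩
  rw [himg]
  apply le_antisymm
  · calc closure ((V.toSubgroup : Set Fhat) ∩ Set.range ι)
        ⊆ closure (V.toSubgroup : Set Fhat) := closure_mono Set.inter_subset_left
      _ = (V.toSubgroup : Set Fhat) := V.toOpenSubgroup.isClosed.closure_eq
  · exact hι.denseRange.open_subset_closure_inter V.toOpenSubgroup.isOpen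

/-- For an OPEN subgroup `U ≤ F` of FINITE INDEX there is an open normal subgroup `V` of the profinite
completion with `ι⁻¹(V) ≤ U` and `V ⊆` the closure of `ι(U)` (take `ι⁻¹(V) =` the normal core of `U`,
which is open normal of finite index, hence pulled back from `F̂`). [cite: MochizukiSemiAnbd2006, §6 p.69] -/
theorem exists_openNormal_le (hι : IsProfiniteCompletion ι) (U : Subgroup F) (hU : IsOpen (U : Set F))
    [U.FiniteIndex] :
    ∃ V : OpenNormalSubgroup Fhat, V.toSubgroup.comap ι.toMonoidHom ≤ U ∧
      (V.toSubgroup : Set Fhat) ⊆ closure (ι '' (U : Set F)) := by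
  let N : OpenNormalSubgroup F := ⟨⟨U.normalCore, isOpen_normalCore U hU⟩, inferInstance⟩
  obtain ⟨V, hV⟩ := hι.comap_surjective N (by exact Subgroup.finiteIndex_normalCore U)
  have hV' : U.normalCore = V.toSubgroup.comap ι.toMonoidHom := hV
  refine ⟨V, ?_, ?_⟩
  · rw [← hV']
    exact U.normalCore_le
  · rw [← closure_image_comap hι V, ← hV']
    exact closure_mono (Set.image_mono U.normalCore_le)

/-- The closure in `F̂` of the image of an open subgroup of finite index of `F` is OPEN.
[cite: MochizukiSemiAnbd2006, §6 p.69] -/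
theorem isOpen_topologicalClosure_map (hι : IsProfiniteCompletion ι) (U : Subgroup F)
    (hU : IsOpen (U : Set F)) [U.FiniteIndex] :
    IsOpen (((U.map ι.toMonoidHom).topologicalClosure : Subgroup Fhat) : Set Fhat) := by
  obtain ⟨V, -, hV⟩ := exists_openNormal_le hι U hU
  have hle : V.toSubgroup ≤ (U.map ι.toMonoidHom).topologicalClosure := by
    intro z hz
    have hz' : z ∈ closure (ι '' (U : Set F)) := hV hz
    rwa [← coe_topologicalClosure_map] at hz'
  exact Subgroup.isOpen_mono hle V.toOpenSubgroup.isOpen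

/-- Set form of `isOpen_topologicalClosure_map`: the closure in the profinite completion of the image of
an open subgroup of finite index is open ("replacing `F` by an open subgroup of `F` of finite index",
[SemiAnbd] proof of Lem. 6.3 (ii) p. 70). [cite: MochizukiSemiAnbd2006, §6 p.69] -/
theorem isOpen_closure_image (hι : IsProfiniteCompletion ι) (U : Subgroup F)
    (hU : IsOpen (U : Set F)) [U.FiniteIndex] : IsOpen (closure (ι '' (U : Set F))) := by
  rw [← coe_topologicalClosure_map]
  exact isOpen_topologicalClosure_map hι U hU

/-- For an open subgroup `U ≤ F` of finite index, `ι⁻¹` of the closure of `ι(U)` is `U` itself (the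
closure is `ι(U)·V` for the open normal `V` with `ι⁻¹(V) =` the normal core of `U`).
[cite: MochizukiSemiAnbd2006, §6 p.69] -/
theorem comap_topologicalClosure_map (hι : IsProfiniteCompletion ι) (U : Subgroup F)
    (hU : IsOpen (U : Set F)) [U.FiniteIndex] :
    ((U.map ι.toMonoidHom).topologicalClosure).comap ι.toMonoidHom = U := by
  obtain ⟨V, hVU, hV⟩ := exists_openNormal_le hι U hU
  set W : Subgroup Fhat := (U.map ι.toMonoidHom).topologicalClosure with hWdef
  have hVW : V.toSubgroup ≤ W := by
    intro z hz
    have hz' : z ∈ closure (ι '' (U : Set F)) := hV hz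
    rwa [← coe_topologicalClosure_map] at hz'
  have hW : W = U.map ι.toMonoidHom ⊔ V.toSubgroup := by
    apply le_antisymm
    · refine Subgroup.topologicalClosure_minimal _ le_sup_left ?_
      exact Subgroup.isClosed_of_isOpen _
        (Subgroup.isOpen_mono le_sup_right V.toOpenSubgroup.isOpen)
    · exact sup_le (Subgroup.le_topologicalClosure _) hVW
  apply le_antisymm
  · intro x hx
    rw [Subgroup.mem_comap, hW] at hx
    have hx' : (ι.toMonoidHom x : Fhat) ∈
        ((U.map ι.toMonoidHom : Subgroup Fhat) : Set Fhat) * ((V.toSubgroup : Subgroup Fhat) : Set Fhat) := by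
      rw [← Subgroup.mul_normal]
      exact hx
    obtain ⟨a, ha, b, hb, hab⟩ := Set.mem_mul.mp hx'
    obtain ⟨u, hu, rfl⟩ := ha
    have hb' : b = ι.toMonoidHom (u⁻¹ * x) := by
      rw [map_mul, map_inv, ← hab, inv_mul_cancel_left]
    have hux : u⁻¹ * x ∈ U := hVU (by rw [Subgroup.mem_comap, ← hb']; exact hb)
    simpa using U.mul_mem hu hux
  · intro x hx
    exact Subgroup.mem_comap.mpr (Subgroup.le_topologicalClosure _ (Subgroup.mem_map_of_mem _ hx))

/-- Membership form of `comap_topologicalClosure_map`: `ι x ∈ closure (ι U)` implies `x ∈ U` for an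
open subgroup `U` of finite index ("natural injections `Π^temp ↪ Π`", p. 69).
[cite: MochizukiSemiAnbd2006, §6 p.69] -/
theorem mem_of_map_mem_closure (hι : IsProfiniteCompletion ι) (U : Subgroup F)
    (hU : IsOpen (U : Set F)) [U.FiniteIndex] {x : F} (hx : ι x ∈ closure (ι '' (U : Set F))) :
    x ∈ U := by
  have h := comap_topologicalClosure_map hι U hU
  rw [← h, Subgroup.mem_comap]
  show ι x ∈ (U.map ι.toMonoidHom).topologicalClosure
  rw [← SetLike.mem_coe, coe_topologicalClosure_map]
  exact hx

/-! ### Row T64-L03b of the sub-DAG of [SemiAnbd] Thm. 6.4, generic form -/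

section OpenImage

variable {F₂ : Type u'} {Fhat₂ : Type v'} [Group F₂] [TopologicalSpace F₂] [IsTopologicalGroup F₂]
  [Group Fhat₂] [TopologicalSpace Fhat₂] [IsTopologicalGroup Fhat₂] {ι₂ : F₂ →ₜ* Fhat₂}

omit [IsTopologicalGroup F] [IsTopologicalGroup Fhat] in
/-- **"Profinite completion yields an open homomorphism"** ([SemiAnbd] Thm. 6.4, proof p. 71
ll. 4–5): if `φ : F → F₂` has image of DOF-type (dense in an open subgroup of finite index) and
`Φ : F̂ → F̂₂` extends `φ` along the profinite completions, then `Φ` has OPEN image — its image is the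
closure of `ι₂(Im φ)`, which contains the (open) closure of `ι₂(U)`.
[cite: MochizukiSemiAnbd2006, Thm 6.4 proof p.71] -/
theorem isOpen_range_of_extends (hι : IsProfiniteCompletion ι) (hι₂ : IsProfiniteCompletion ι₂)
    (φ : F →ₜ* F₂) (Φ : Fhat →ₜ* Fhat₂) (hΦ : ∀ x : F, Φ (ι x) = ι₂ (φ x))
    (hφ : IsDOFType φ.toMonoidHom.range) : IsOpen (Set.range Φ) := by
  haveI : CompactSpace Fhat := hι.compactSpace
  haveI : T2Space Fhat₂ := hι₂.t2Space
  obtain ⟨U, hUo, hUfi, hUcl⟩ := hφ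
  haveI := hUfi
  -- `range Φ` is the closure of `Φ (ι F) = ι₂ (φ F)`
  have h1 : Set.range Φ = closure (Φ '' Set.range ι) := by
    apply le_antisymm
    · have hd : closure (Set.range ι) = Set.univ := hι.denseRange.closure_range
      rw [← Set.image_univ, ← hd]
      exact image_closure_subset_closure_image Φ.continuous
    · exact closure_minimal (Set.image_subset_range _ _) (isCompact_range Φ.continuous).isClosed
  have h2 : Φ '' Set.range ι = ι₂ '' ((φ.toMonoidHom.range : Subgroup F₂) : Set F₂) := by
    ext z
    constructor
    · rintro ⟨_, ⟨x, rfl⟩, rfl⟩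
      exact ⟨φ x, ⟨x, rfl⟩, (hΦ x).symm⟩
    · rintro ⟨_, ⟨x, rfl⟩, rfl⟩
      exact ⟨ι x, ⟨x, rfl⟩, hΦ x⟩
  rw [h1, h2, ← coe_topologicalClosure_map]
  -- the closure of `ι₂ (φ F)` contains the closure of `ι₂ U`, which is open
  have h3 : (U.map ι₂.toMonoidHom).topologicalClosure ≤
      ((φ.toMonoidHom.range).map ι₂.toMonoidHom).topologicalClosure := by
    intro z hz
    rw [← SetLike.mem_coe, coe_topologicalClosure_map] at hz ⊢
    refine closure_minimal ?_ isClosed_closure hz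
    rw [← hUcl]
    exact image_closure_subset_closure_image ι₂.continuous
  exact Subgroup.isOpen_mono h3 (isOpen_topologicalClosure_map hι₂ U hUo)

end OpenImage

/-! ### Row T64-L07 ⇐ T64-L06′ of the sub-DAG of [SemiAnbd] Thm. 6.4, generic form -/

/-- A conjugate of a DOF-type subgroup ([SemiAnbd] Def. 6.2 (ii)) is of DOF-type (conjugation is a
homeomorphism preserving the index). [cite: MochizukiSemiAnbd2006, Def 6.2(ii) p.70] -/
theorem isDOFType_map_conj {H : Subgroup F} (hH : IsDOFType H) (y : F) :
    IsDOFType (H.map (MulAut.conj y).toMonoidHom) := by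
  obtain ⟨U, hUo, hUfi, hUcl⟩ := hH
  haveI := hUfi
  let e : F ≃ₜ F := (Homeomorph.mulLeft y).trans (Homeomorph.mulRight y⁻¹)
  have hcoe : ∀ K : Subgroup F, ((K.map (MulAut.conj y).toMonoidHom : Subgroup F) : Set F) =
      e '' (K : Set F) := fun K => by
    ext z
    simp only [Subgroup.coe_map, Set.mem_image, SetLike.mem_coe]
    constructor
    · rintro ⟨x, hx, rfl⟩
      exact ⟨x, hx, rfl⟩
    · rintro ⟨x, hx, rfl⟩
      exact ⟨x, hx, rfl⟩
  refine ⟨U.map (MulAut.conj y).toMonoidHom, ?_, ?_, ?_⟩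
  · rw [hcoe]
    exact e.isOpenMap _ hUo
  · exact ⟨by rw [Subgroup.index_map_of_bijective (MulAut.conj y).bijective]; exact hUfi.index_ne_zero⟩
  · rw [hcoe, hcoe, ← e.image_closure, hUcl]

/-- **"By Lemma 6.3, (iii), we thus conclude that `φ` differs from `ψ` by composition with an inner
automorphism of `Π^temp`"** ([SemiAnbd] Thm. 6.4, proof p. 71 ll. 8–11), generic form = row
T64-L07 ⇐ T64-L06′: assume Lemma 6.3 (iii) for every open subgroup of finite index `U ≤ F` with
`Û =` the closure of `ι(U)` (hypothesis `h63`, the shape of `TemperedCurve.OpenDenseDOFConjugator`),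
`ι` injective; if `φ, ψ : X → F` have DOF-type images and `ι ∘ φ = Inn(c) ∘ ι ∘ ψ` for some `c ∈ F̂`,
then `φ = Inn(y) ∘ ψ` for some `y ∈ F`.  (Reduction as in print: pass to `U := closure(Im ψ)`, move
`c` into `Û` by an element of `F` using the density of `ι(F)` and the openness of `Û`, apply 6.3 (iii)
inside `U`.) [cite: MochizukiSemiAnbd2006, Thm 6.4 proof p.71] -/
theorem outer_descent_of_openDenseDOFConjugator (hι : IsProfiniteCompletion ι)
    (hinj : Function.Injective ι)
    (h63 : ∀ U : Subgroup F, IsOpen (U : Set F) → U.FiniteIndex →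
      ∀ F₁ F₂ : Subgroup F, F₁ ≤ U → F₂ ≤ U → IsDOFType F₁ → IsDOFType F₂ →
        closure (ι '' (F₁ : Set F)) = closure (ι '' (U : Set F)) →
        closure (ι '' (F₂ : Set F)) = closure (ι '' (U : Set F)) →
        ∀ c : Fhat, c ∈ closure (ι '' (U : Set F)) →
          (ConjAct.toConjAct c) • F₁.map ι.toMonoidHom = F₂.map ι.toMonoidHom →
            c ∈ ι '' (U : Set F))
    {X : Type w} [Group X] (φ ψ : X →* F) (hφ : IsDOFType φ.range) (hψ : IsDOFType ψ.range)
    (c : Fhat) (hc : ∀ x : X, ι (φ x) = c * ι (ψ x) * c⁻¹) :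
    ∃ y : F, ∀ x : X, φ x = y * ψ x * y⁻¹ := by
  obtain ⟨U, hUo, hUfi, hUcl⟩ := hψ
  haveI := hUfi
  -- `Û := closure (ι U)`, an open subgroup of `F̂`
  set W : Subgroup Fhat := (U.map ι.toMonoidHom).topologicalClosure with hWdef
  have hWcoe : (W : Set Fhat) = closure (ι '' (U : Set F)) := coe_topologicalClosure_map U
  have hWopen : IsOpen (W : Set Fhat) := isOpen_topologicalClosure_map hι U hUo
  -- `Im ψ ≤ U` and `ι (Im ψ)`, `ι U` have the same closure
  have hψU : ψ.range ≤ U := by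
    intro z hz
    have : z ∈ closure ((ψ.range : Subgroup F) : Set F) := subset_closure hz
    rwa [hUcl] at this
  have hdense₁ : closure (ι '' ((ψ.range : Subgroup F) : Set F)) = closure (ι '' (U : Set F)) := by
    apply le_antisymm (closure_mono (Set.image_mono hψU))
    refine closure_minimal ?_ isClosed_closure
    rw [← hUcl]
    exact image_closure_subset_closure_image ι.continuous
  -- move `c` into `Û` by an element `y₀ ∈ F`: `c = ι y₀ * c'` with `c' ∈ Û`
  have ho : IsOpen ((fun w : Fhat => c * w⁻¹) '' (W : Set Fhat)) := by
    have : (fun w : Fhat => c * w⁻¹) '' (W : Set Fhat) = (Homeomorph.mulLeft c) '' (W : Set Fhat) := by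
      ext z
      simp only [Set.mem_image, Homeomorph.coe_mulLeft, SetLike.mem_coe]
      constructor
      · rintro ⟨w, hw, rfl⟩; exact ⟨w⁻¹, W.inv_mem hw, rfl⟩
      · rintro ⟨w, hw, rfl⟩; exact ⟨w⁻¹, W.inv_mem hw, by rw [inv_inv]⟩
    rw [this]
    exact (Homeomorph.mulLeft c).isOpenMap _ hWopen
  obtain ⟨y₀, hy₀⟩ := hι.denseRange.exists_mem_open ho ⟨c * 1⁻¹, 1, W.one_mem, rfl⟩
  obtain ⟨w, hwW, hw⟩ := hy₀
  -- `c' := (ι y₀)⁻¹ * c = w ∈ Û`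
  set c' : Fhat := (ι y₀)⁻¹ * c with hc'def
  have hc'eq : c' = w := by
    have hw' : c * w⁻¹ = ι y₀ := hw
    rw [hc'def, ← hw']
    group
  have hc'W : c' ∈ W := hc'eq ▸ hwW
  -- `φ' := Inn(y₀⁻¹) ∘ φ` satisfies `ι ∘ φ' = Inn(c') ∘ ι ∘ ψ`
  let φ' : X →* F := (MulAut.conj y₀⁻¹).toMonoidHom.comp φ
  have hφ' : ∀ x, φ' x = y₀⁻¹ * φ x * y₀ := fun x => by
    simp [φ']
  have hc' : ∀ x, ι (φ' x) = c' * ι (ψ x) * c'⁻¹ := fun x => by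
    rw [hφ', map_mul, map_mul, map_inv, hc x, hc'def]
    group
  -- `Im φ' ≤ U` (through `ι⁻¹ Û = U`) and density of `ι (Im φ')` in `Û`
  have hmemW : ∀ x, ι (φ' x) ∈ W := fun x => by
    rw [hc' x]
    refine W.mul_mem (W.mul_mem hc'W ?_) (W.inv_mem hc'W)
    exact Subgroup.le_topologicalClosure _ (Subgroup.mem_map_of_mem _ (hψU ⟨x, rfl⟩))
  have hφ'U : φ'.range ≤ U := by
    rintro _ ⟨x, rfl⟩
    refine mem_of_map_mem_closure hι U hUo ?_
    rw [← hWcoe]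
    exact hmemW x
  have hrange : φ'.range = (φ.range).map (MulAut.conj y₀⁻¹).toMonoidHom := by
    rw [MonoidHom.range_comp]
  have hφ'dof : IsDOFType φ'.range := hrange ▸ isDOFType_map_conj hφ y₀⁻¹
  let eC : Fhat ≃ₜ Fhat := (Homeomorph.mulLeft c').trans (Homeomorph.mulRight c'⁻¹)
  have himg : ι '' ((φ'.range : Subgroup F) : Set F) = eC '' (ι '' ((ψ.range : Subgroup F) : Set F)) := by
    ext z
    simp only [Set.mem_image, SetLike.mem_coe, MonoidHom.mem_range]
    constructor
    · rintro ⟨_, ⟨x, rfl⟩, rfl⟩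
      exact ⟨ι (ψ x), ⟨ψ x, ⟨x, rfl⟩, rfl⟩, by rw [hc' x]; rfl⟩
    · rintro ⟨_, ⟨_, ⟨x, rfl⟩, rfl⟩, rfl⟩
      exact ⟨φ' x, ⟨x, rfl⟩, by rw [hc' x]; rfl⟩
  have hdense₂ : closure (ι '' ((φ'.range : Subgroup F) : Set F)) = closure (ι '' (U : Set F)) := by
    rw [himg, ← eC.image_closure, hdense₁, ← hWcoe]
    -- `c' Û c'⁻¹ = Û` since `c' ∈ Û`
    ext z
    simp only [Set.mem_image, SetLike.mem_coe]
    constructor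
    · rintro ⟨w', hw', rfl⟩
      exact W.mul_mem (W.mul_mem hc'W hw') (W.inv_mem hc'W)
    · intro hz
      exact ⟨c'⁻¹ * z * c', W.mul_mem (W.mul_mem (W.inv_mem hc'W) hz) hc'W, by
        show c' * (c'⁻¹ * z * c') * c'⁻¹ = z; group⟩
  -- the conjugation relation between the images, as subgroups of `F̂`
  have hconj : (ConjAct.toConjAct c') • (ψ.range).map ι.toMonoidHom = (φ'.range).map ι.toMonoidHom := by
    ext z
    rw [Subgroup.mem_smul_pointwise_iff_exists]
    simp only [Subgroup.mem_map, MonoidHom.mem_range, ConjAct.toConjAct_smul,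
      ContinuousMonoidHom.coe_toMonoidHom]
    constructor
    · rintro ⟨_, ⟨_, ⟨x, rfl⟩, rfl⟩, rfl⟩
      exact ⟨φ' x, ⟨x, rfl⟩, hc' x⟩
    · rintro ⟨_, ⟨x, rfl⟩, rfl⟩
      exact ⟨ι (ψ x), ⟨ψ x, ⟨x, rfl⟩, rfl⟩, (hc' x).symm⟩
  -- Lemma 6.3 (iii) inside `U`: `c' ∈ ι U`
  have hc'U : c' ∈ ι '' (U : Set F) :=
    h63 U hUo hUfi ψ.range φ'.range hψU hφ'U ⟨U, hUo, hUfi, hUcl⟩ hφ'dof hdense₁ hdense₂ c'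
      (by rw [← hWcoe]; exact hc'W) hconj
  obtain ⟨u, -, hu⟩ := hc'U
  refine ⟨y₀ * u, fun x => ?_⟩
  have h1 : φ' x = u * ψ x * u⁻¹ := by
    apply hinj
    rw [hc' x, ← hu, map_mul, map_mul, map_inv]
  have h2 : φ x = y₀ * φ' x * y₀⁻¹ := by
    rw [hφ' x]
    group
  rw [h2, h1]
  group

end IsProfiniteCompletion

end Literature.AnabelianGeometry.SemiGraphs

end
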